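import Literature.IUT.HodgeTheaters.PuncturedEllipticCoveringsModel
import HarnessLib

/-!
# [IUTchI] Cor. 1.2 (Characteristic Nature of Coverings): the predicate `CharacteristicNatureOfCoverings` on pairs of
# `PuncturedEllipticData` is a SCHEMA — universal-closure certificate (proof-only)

S. Mochizuki, *Inter-universal Teichmüller theory I*, kurims manuscript (May 2020), §1, Corollary 1.2 p. 39 ("there exists
a functorial group-theoretic algorithm to reconstruct `Π_X̲`, `Π_{C→}`, `Π_C̲` together with the conjugacy classes of the
decomposition group[s] … determined by the set[s] of cusps `{ε′, ε″}`; `{ε̲}` … from `Π_{X→}`") [claim: Mochizuki2012,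
status: disputed] (IUTchI §1 Cor 1.2, kurims p.39).  abc-iut cell, FACT-LIST row **F-2587** of layer L5 (seat
abc-iut-w6-d089 gen 5, row «KL5-CLOSURE-CERTS-3»).  PROOF-ONLY companion of abc-iut-L5-t1's `PuncturedEllipticCoverings.lean`
and of the L5 model file `PuncturedEllipticCoveringsModel.lean` (no `def`, no `instance`, nothing re-typed).

The row was «LABEL-OPEN, model-witness»: the tree holds the instance-form theorems
`characteristicNatureOfCoverings_of_core_extensions` / `_of_core_isos` / `_of_geomIsMaxTFG_of_recoversCusps` (abc-iut-L5-d4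
lineage) and the model witness `TrivialModel.characteristicNatureOfCoverings` (the pair `(toyDatum, toyDatum)`), but no
universal-closure decision.  `CharacteristicNatureOfCoverings D D'` (extensional form of "a group-theoretic algorithm
reconstructs … from `Π_{X→}`") compares TWO data; the interface `PuncturedEllipticData` records the cusps `ε⁰, ε′, ε″, 2ε`
as LABELS on an abstract type with representative decomposition groups, constrained only by distinctness, `D_x ⊆ Π_X̲`
and `D_{2ε} ↠ G_k`.  These constraints are symmetric in the labels `ε⁰ ↔ ε′`, so the tree's own §1 model `toyDatum`
(`Π_C = ℤ/10`, `G_k = 1`, `Π_X̲ = 2ℤ/10`, decomposition groups `1, Π_X̲, Π_X̲, 1` at `ε⁰, ε′, ε″, 2ε`) has a twin `D′`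
with the labels `ε⁰`, `ε′` exchanged.  Both have `Π_{X→} = 1` (the only input of the "algorithm"), but the class of
cusps `{ε′, ε″}` is ONE conjugacy class of subgroups `{Π_X̲}` for the toy and TWO `{1, Π_X̲}` for `D′`: no isomorphism
`Π_C̲ ⥲ Π_C̲` carries a one-element set of subgroups onto a two-element one.

* `not_characteristicNatureOfCoverings_of_cuspClassX` — WHICH DEGENERATION KILLS THE CLAUSE: a bi-continuous
  `Π_{X→} ⥲ Π′_{X→}` together with «all members of `cuspClassX D` coincide» and «`cuspClassX D′` has two distinct
  members» falsify Cor. 1.2 for the pair `(D, D′)`;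
* `exists_not_characteristicNatureOfCoverings` — the pair `(toyDatum, D′)` is such; `not_forall_characteristicNatureOfCoverings`
  — **F-2587 is a schema**: the universal closure is FALSE, while `(toyDatum, toyDatum)` satisfies the predicate
  (`TrivialModel.characteristicNatureOfCoverings`): consistent ∧ independent; the instance forms are the content.

HONEST FRAMING: the witness exploits that OUR interface lets the label `ε⁰` sit on a cusp with the large decomposition
group while `ε′` carries the trivial one — in print `ε⁰` is the origin of the once-punctured elliptic curve and `ε′, ε″`
are the two cusps of `X̲` over `ε̲`, determined by the geometry, and `Π_{X→}` is an infinite profinite group from which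
the algorithm genuinely starts.  A refuted universal closure is a statement about our typing, not about Cor. 1.2.
Nothing here bears on [IUTchIII] Cor. 3.12 or takes a side; typed ≠ proved; refuted-as-typed ≠ refuted-in-print.
-/

namespace Literature.IUT.HodgeTheaters

namespace PuncturedEllipticData

open Topology
open scoped Pointwise

universe u

/-! ## Which degeneration kills the clause -/

/-- **IUTchI:Cor1.2** (kurims p.39) fails for a pair `(D, D′)` as soon as there is a bi-continuous isomorphism
`Π_{X→} ⥲ Π′_{X→}` while ALL members of the class `cuspClassX D` (conjugates of `D_{ε′}`, `D_{ε″}` in `Π_C̲`) coincide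
and `cuspClassX D′` has two DISTINCT members: the required `Φ : Π_C̲ ⥲ Π′_C̲` would map the former set onto the latter.
[claim: Mochizuki2012, status: disputed] (IUTchI §1 Cor 1.2, kurims p.39) -/
theorem not_characteristicNatureOfCoverings_of_cuspClassX (D D' : PuncturedEllipticData.{u})
    (φ : D.piXarrow ≃* D'.piXarrow) (hφ : Continuous φ) (hφ' : Continuous φ.symm)
    (hD : ∀ K₁ ∈ D.cuspClassX, ∀ K₂ ∈ D.cuspClassX, K₁ = K₂) {L₁ L₂ : Subgroup D'.PiCbar}
    (h₁ : L₁ ∈ D'.cuspClassX) (h₂ : L₂ ∈ D'.cuspClassX) (hne : L₁ ≠ L₂) :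
    ¬ D.CharacteristicNatureOfCoverings D' := by
  intro h
  obtain ⟨Φ, -, -, -, -, hX, -⟩ := h.ofXarrow φ hφ hφ'
  rw [← hX] at h₁ h₂
  obtain ⟨K₁, hK₁, rfl⟩ := h₁
  obtain ⟨K₂, hK₂, rfl⟩ := h₂
  exact hne (by rw [hD K₁ hK₁ K₂ hK₂])

/-! ## The label-swapped twin of the §1 model and the closed certificate -/

namespace TrivialModel

/-- **A pair of inhabitants falsifying Cor. 1.2 as typed**: `D = toyDatum` (the tree's §1 model) and `D′ =` the same
datum with the labels `ε⁰ ↔ ε′` exchanged.  `Π_{X→}(D) = Π_{X→}(D′) = 1`; `cuspClassX D = {Π_X̲}`;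
`cuspClassX D′ ∋ 1, Π_X̲`. [claim: Mochizuki2012, status: disputed] (IUTchI §1 Cor 1.2, kurims p.39) -/
theorem exists_not_characteristicNatureOfCoverings :
    ∃ D D' : PuncturedEllipticData.{0}, ¬ D.CharacteristicNatureOfCoverings D' := by
  let D' : PuncturedEllipticData.{0} :=
    { toyDatum with
      ε0 := .e1
      ε1 := .e0
      ε1_ne_ε0 := by decide
      ε2_ne_ε0 := by decide
      ε1_ne_ε2 := by decide
      twoε_ne := by decide }
  -- the construction of pp. 37–38 collapses for `D′` exactly as for the toy: `Π_{X→}(D′) = 1`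
  have hmod : D'.modLKer = ⊥ := modLKer_eq_bot
  have hinertia : ∀ x, D'.inertia x = decomp x := inertia_eq
  have hdek : D'.deltaEpsKer = ⊥ := by
    show D'.modLKer ⊔ ⨆ x : {x : Cusp // D'.IsNonzeroCusp x ∧ x ≠ Cusp.e0 ∧ x ≠ Cusp.e2},
      D'.inertia x.1 = ⊥
    rw [hmod, bot_sup_eq, eq_bot_iff]
    refine iSup_le fun x => ?_
    obtain ⟨x, hx0, hx1, hx2⟩ := x
    rw [hinertia]
    cases x <;> first | exact absurd rfl hx0 | exact absurd rfl hx1 | exact absurd rfl hx2 | exact le_rfl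
  have hj : D'.jKer = ⊥ := by
    show D'.deltaEpsKer ⊔ Subgroup.closure {z : Amb | ∃ x ∈ D'.DeltaXbar,
      ∃ c ∈ D'.DeltaCbar, c ∉ D'.DeltaXbar ∧ z = x * c * x⁻¹ * c⁻¹} = ⊥
    rw [hdek, bot_sup_eq, eq_bot_iff, Subgroup.closure_le]
    rintro _ ⟨x, -, c, -, -, rfl⟩
    rw [SetLike.mem_coe, Subgroup.mem_bot, mul_comm x c, mul_inv_cancel_right, mul_inv_cancel]
  have hpx : D'.piXarrow = ⊥ := by
    show decomp Cusp.e22 ⊔ D'.jKer = ⊥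
    rw [hj, show decomp Cusp.e22 = ⊥ from rfl, bot_sup_eq]
  -- the (unique) isomorphism of trivial groups `Π_{X→}(toy) ⥲ Π_{X→}(D′)`, continuous (discrete groups)
  let φ : toyDatum.piXarrow ≃* D'.piXarrow := MulEquiv.subgroupCongr (piXarrow_eq_bot.trans hpx.symm)
  -- conjugation is trivial in the abelian `Π_C̲ = ℤ/10`
  have hconj : ∀ (t : toyDatum.PiCbar) (H : Subgroup toyDatum.PiCbar), MulAut.conj t • H = H := by
    intro t H
    ext x
    rw [Subgroup.mem_pointwise_smul_iff_inv_smul_mem, ← map_inv, MulAut.smul_def, MulAut.conj_apply,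
      mul_inv_cancel_comm]
  -- toy: the class of `{ε′, ε″}` is the single subgroup `Π_X̲`
  have hD : ∀ K₁ ∈ toyDatum.cuspClassX, ∀ K₂ ∈ toyDatum.cuspClassX, K₁ = K₂ := by
    have key : ∀ K ∈ toyDatum.cuspClassX, K = PiXm.subgroupOf ⊤ := by
      rintro K ⟨t, -, e, he, rfl⟩
      rw [hconj]
      rcases he with rfl | rfl <;> rfl
    intro K₁ hK₁ K₂ hK₂
    rw [key K₁ hK₁, key K₂ hK₂]
  -- `D′`: the class of `{ε′, ε″} = {e0, e2}` contains `1` and `Π_X̲`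
  have h₁ : (⊥ : Subgroup Amb).subgroupOf ⊤ ∈ D'.cuspClassX :=
    ⟨1, one_mem _, Cusp.e0, Or.inl rfl, by rw [map_one, one_smul]; rfl⟩
  have h₂ : PiXm.subgroupOf ⊤ ∈ D'.cuspClassX :=
    ⟨1, one_mem _, Cusp.e2, Or.inr rfl, by rw [map_one, one_smul]; rfl⟩
  have hne : (⊥ : Subgroup Amb).subgroupOf (⊤ : Subgroup Amb) ≠ PiXm.subgroupOf ⊤ := by
    intro h
    have hmem : (⟨Multiplicative.ofAdd 2, Subgroup.mem_top _⟩ : (⊤ : Subgroup Amb)) ∈ PiXm.subgroupOf ⊤ := by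
      rw [Subgroup.mem_subgroupOf, mem_piXm_iff]
      decide
    rw [← h, Subgroup.mem_subgroupOf, Subgroup.mem_bot] at hmem
    exact absurd hmem (by decide)
  exact ⟨toyDatum, D', not_characteristicNatureOfCoverings_of_cuspClassX toyDatum D' φ
    continuous_of_discreteTopology continuous_of_discreteTopology hD h₁ h₂ hne⟩

/-- **F-2587 is a schema**: the universal closure of `PuncturedEllipticData.CharacteristicNatureOfCoverings` is FALSE
(the pair `(toyDatum, D′)` above), while the pair `(toyDatum, toyDatum)` satisfies it
(`TrivialModel.characteristicNatureOfCoverings`); the content is the instance-form theorems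
`characteristicNatureOfCoverings_of_core_extensions` / `_of_core_isos`. [claim: Mochizuki2012, status: disputed]
(IUTchI §1 Cor 1.2, kurims p.39) -/
theorem not_forall_characteristicNatureOfCoverings :
    ¬ ∀ D D' : PuncturedEllipticData.{0}, D.CharacteristicNatureOfCoverings D' := fun h => by
  obtain ⟨D, D', hDD'⟩ := exists_not_characteristicNatureOfCoverings
  exact hDD' (h D D')

/-- The row is a SCHEMA (consistent ∧ independent): one pair of data satisfies the typed Cor. 1.2, another does not.
[claim: Mochizuki2012, status: disputed] (IUTchI §1 Cor 1.2, kurims p.39) -/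
theorem characteristicNatureOfCoverings_schema :
    (∃ D D' : PuncturedEllipticData.{0}, D.CharacteristicNatureOfCoverings D') ∧
      ∃ D D' : PuncturedEllipticData.{0}, ¬ D.CharacteristicNatureOfCoverings D' :=
  ⟨⟨toyDatum, toyDatum, characteristicNatureOfCoverings⟩, exists_not_characteristicNatureOfCoverings⟩

end TrivialModel

end PuncturedEllipticData

end Literature.IUT.HodgeTheaters
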